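import Mathlib.NumberTheory.NumberField.Basic
import Mathlib.RingTheory.DedekindDomain.Dvr
import Mathlib.RingTheory.DedekindDomain.PID
import Mathlib.RingTheory.Localization.AtPrime.Basic
import Mathlib.RingTheory.Filtration
import Mathlib.LinearAlgebra.FreeModule.IdealQuotient
import Mathlib.RingTheory.DiscreteValuationRing.Basic
import HarnessLib

/-!
# TwoAdicLadder — crux `TwoIntegralNormalisation` (stmt-ValiantsHypothesis-5947), line `birth`:
# stub `stub_chainRingReduction` (finite chain-ring quotients of every 2-adic length)

Route `ValiantsHypothesis/TwoAdicLadder`, crux `TwoIntegralNormalisation`, registered line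
`Cruxes/TwoIntegralNormalisation/Lines/birth.lean` (algebraic constants → elimination of `1/2` into
`𝓞_(𝔭)` → finite chain-ring quotients). This file proves the line's pure algebraic-number-theory
stub, verbatim:

* `stub_chainRingReduction` — for a number field `K`, a prime `𝔭` of `𝓞 K` containing `2`, and
  every `k`, there is a finite commutative principal ideal ring `R` in which `2` is nilpotent but
  `2^k ≠ 0`, together with a ring homomorphism `𝓞_{K,(𝔭)} = Localization.AtPrime 𝔭 → R`.

Proof: `R := 𝓞 K ⧸ 𝔭^N` with `N` so large that `2^k ∉ 𝔭^N` (Krull's intersection theorem in the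
Noetherian domain `𝓞 K`); `R` is finite (`𝔭^N ≠ 0` in a free `ℤ`-module of finite rank), `2^N ∈ 𝔭^N`
so `2` is nilpotent; `𝔭 ∋ 2 ≠ 0` is maximal (Dedekind), so `𝓞 K ⧸ 𝔭^N ≅ 𝓞_(𝔭) ⧸ 𝔪^N`
(Mathlib `IsLocalization.AtPrime.equivQuotMaximalIdealPow`), which gives the map from `𝓞_(𝔭)`
and makes `R` a quotient of the discrete valuation ring `𝓞_(𝔭)`, hence a principal ideal ring.

Honest framing: a bookkeeping stub; the load-bearing stub of the line (`stub_halfElim`,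
elimination of the constant `1/2`) and the crux stay open; VP ≠ VNP is NOT proved here.
-/

noncomputable section

-- the summit and the problem share the name `ValiantsHypothesis` (D-0017 single-conjunct layout)
set_option linter.dupNamespace false

namespace Summit.ValiantsHypothesis.ValiantsHypothesis.Theorems.TwoAdicLadder.TwoIntegralNormalisation

open NumberField IsLocalRing

/-- **Stub `ChainRingReduction`** (registered obligation `stub_chainRingReduction` of crux
`TwoIntegralNormalisation`, line `birth`; signature verbatim): for every number field `K`, every
prime ideal `𝔭` of `𝓞 K` with `2 ∈ 𝔭` and every `k`, there is a finite commutative principal ideal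
ring `R` with `2` nilpotent, `2 ^ k ≠ 0`, and a ring map `Localization.AtPrime 𝔭 →+* R`
(namely `R = 𝓞 K ⧸ 𝔭^N ≅ 𝓞_(𝔭) ⧸ 𝔪^N` for `N` large). [folklore; Neukirch, *Algebraic Number
Theory*, I §3 and §11 (quotients of Dedekind domains / localisation at a prime)] -/
theorem stub_chainRingReduction :
    ∀ (K : Type) [Field K] [NumberField K] (P : Ideal (NumberField.RingOfIntegers K)) [P.IsPrime],
      (2 : NumberField.RingOfIntegers K) ∈ P → ∀ k : ℕ,
        ∃ (R : Type) (_ : CommRing R) (_ : Fintype R),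
          IsPrincipalIdealRing R ∧ IsNilpotent (2 : R) ∧ (2 : R) ^ k ≠ 0 ∧
          Nonempty (Localization.AtPrime P →+* R) := by
  intro K _ _ P _ h2 k
  -- `𝔭 ≠ 0`, hence maximal
  have hP0 : P ≠ ⊥ := by
    intro h
    rw [h, Ideal.mem_bot] at h2
    exact two_ne_zero h2
  haveI hPmax : P.IsMaximal := Ideal.IsPrime.isMaximal inferInstance hP0
  -- choose `N` with `2 ^ k ∉ 𝔭 ^ N` (Krull intersection theorem)
  have h2k : ((2 : 𝓞 K) ^ k) ≠ 0 := pow_ne_zero k two_ne_zero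
  have hex : ∃ N : ℕ, (2 : 𝓞 K) ^ k ∉ P ^ N := by
    by_contra hcon
    simp only [not_exists, not_not] at hcon
    have hmem : (2 : 𝓞 K) ^ k ∈ ⨅ i : ℕ, P ^ i := Ideal.mem_iInf.2 hcon
    rw [Ideal.iInf_pow_eq_bot_of_isDomain P hPmax.ne_top, Ideal.mem_bot] at hmem
    exact h2k hmem
  obtain ⟨N, hN⟩ := hex
  have hPN0 : P ^ N ≠ ⊥ := pow_ne_zero N hP0
  -- the ring `R = 𝓞 K ⧸ 𝔭 ^ N`
  haveI : Finite (𝓞 K ⧸ P ^ N) := Ideal.finiteQuotientOfFreeOfNeBot (P ^ N) hPN0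
  letI : Fintype (𝓞 K ⧸ P ^ N) := Fintype.ofFinite _
  -- the map from the localisation: `𝓞_(𝔭) → 𝓞_(𝔭) ⧸ 𝔪^N ≅ 𝓞 K ⧸ 𝔭^N`
  haveI : IsDiscreteValuationRing (Localization.AtPrime P) :=
    IsLocalization.AtPrime.isDiscreteValuationRing_of_dedekind_domain (𝓞 K) hP0 _
  let e : (𝓞 K ⧸ P ^ N) ≃ₐ[𝓞 K]
      Localization.AtPrime P ⧸ maximalIdeal (Localization.AtPrime P) ^ N :=
    IsLocalization.AtPrime.equivQuotMaximalIdealPow P (Localization.AtPrime P) N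
  let f : Localization.AtPrime P →+* 𝓞 K ⧸ P ^ N :=
    (e.symm : _ ≃ₐ[𝓞 K] _).toRingEquiv.toRingHom.comp (Ideal.Quotient.mk _)
  have hf : Function.Surjective f :=
    e.symm.surjective.comp Ideal.Quotient.mk_surjective
  refine ⟨𝓞 K ⧸ P ^ N, inferInstance, inferInstance, IsPrincipalIdealRing.of_surjective f hf,
    ⟨N, ?_⟩, ?_, ⟨f⟩⟩
  · -- `2 ^ N ∈ 𝔭 ^ N`
    rw [show (2 : 𝓞 K ⧸ P ^ N) = Ideal.Quotient.mk (P ^ N) 2 from rfl, ← map_pow,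
      Ideal.Quotient.eq_zero_iff_mem]
    exact Ideal.pow_mem_pow h2 N
  · rw [show (2 : 𝓞 K ⧸ P ^ N) = Ideal.Quotient.mk (P ^ N) 2 from rfl, ← map_pow, Ne,
      Ideal.Quotient.eq_zero_iff_mem]
    exact hN

end Summit.ValiantsHypothesis.ValiantsHypothesis.Theorems.TwoAdicLadder.TwoIntegralNormalisation

end
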